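import Literature.AlgebraicGeometry.Resolution.RegularLocalRingsNormal
import Mathlib.RingTheory.MvPolynomial.Homogeneous
import Mathlib.Algebra.MvPolynomial.Monad
import Mathlib.Algebra.CharP.Lemmas
import HarnessLib

/-!
# hEv leaf [B] — kernel piece 1: the RESTRICTION IDENTITY in the exceptional divisor
# (Taylor rigidity of low-degree polynomials at a rational regular point; Theses-free, def-free)

OURS (campaign `res-hironaka`, rung L ★L-G4, slot W4.1 · crux `Steer` (stmt-ResolutionOfSingularities-16345) · hEv leaf object
[B] = `BinaryResidueBackward` + `TangentialNeedsBinary` of res-L0-w41-idea-2's `HEV-IDEA-2.md` §2 (Lemma 1 / Lemma 2), kernel owner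
res-type-028 (res-L0-w41-plan-1 RULING 153a)). Not a statement of the manuscript under review [claim: Hironaka2017,
status: under-review]; AI-produced, weaker than expert review.

THE SETTING. `O` is a regular local ring containing (the image of) a field `κ` that maps ONTO the residue field
(`∀ o, ∃ c, o - c ∈ 𝔪_O` — a RATIONAL regular point), `u : Fin n → O` a regular system of parameters. In the application
`O = S' ⧸ (x)` is the local ring of the exceptional divisor `E ≅ ℙ³` at the (rational) centre of the next blow-up, `κ` the
common residue field, `u` the affine coordinates of the chart, and the radicand `f'` of the later member reduces mod `x`
to `C(u)` for a `κ`-polynomial `C` of degree `≤ d = 2e` (the dehomogenised initial form of the cleaned radicand at the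
earlier member).

* §1 `eq_zero_of_totalDegree_le_of_aeval_mem_pow` — TAYLOR RIGIDITY: a `κ`-polynomial `P` of total degree `≤ N` with
  `P(u) ∈ 𝔪_O^(N+1)` is ZERO (lowest homogeneous component + Matsumura 17.10 `gr_𝔪 O = κ[T]`).
* §2 `exists_totalDegree_le_sub_aeval_mem_pow` — every `o ∈ O` is a `κ`-polynomial of degree `≤ N` in `u` modulo `𝔪_O^(N+1)`.
* §3 `exists_isHomogeneous_sub_aeval_bind₁_mem_pow` — an element of `(ℓ₁(u), …, ℓ_m(u))^d` (`ℓ_i` linear forms) is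
  `R(ℓ₁, …, ℓ_m)(u)` modulo `𝔪_O^(d+1)` for a `κ`-form `R` of degree `d` in `m` letters.
* §4 **`eq_sq_add_bind₁_of_sub_sq_mem`** (the restriction identity, characteristic `2`): if
  `C(u) - g² ∈ (ℓ₁(u), …, ℓ_m(u))^d + 𝔪_O^(d+1)` with `deg C ≤ d = 2e`, then `C = q² + R(ℓ₁, …, ℓ_m)` EXACTLY in `κ[T]`, with
  `deg q ≤ e` and `R` a form of degree `d` in `m` letters. With `m = 2` this is «the cleaned initial form restricted to
  `T(E)` is BINARY modulo squares» (idea-2 (★) + Lemma 1), with `ℓ = ` all coordinates it is the CONE CONDITION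
  (constant cleaned order at the next centre makes the initial form a cone over the centre modulo squares).
[cite: Matsumura1987, Thm. 17.10] [folklore]
-/

noncomputable section

-- `Summit.<S>.<S>.…` duplicates the summit name by design (single-problem summit).
set_option linter.dupNamespace false

open IsLocalRing MvPolynomial

namespace Summit.ResolutionOfSingularities.ResolutionOfSingularities.Theorems.SwitchingDichotomy.BinaryResidue

open Literature.AlgebraicGeometry.Resolution

universe u v

/-! ## §0 Polynomial bookkeeping -/

section poly

variable {σ τ : Type*} {R : Type*} [CommRing R]

/-- Substituting linear forms into a form of degree `k` gives a form of degree `k`. [folklore] -/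
theorem isHomogeneous_bind₁ {ℓ : σ → MvPolynomial τ R} (hℓ : ∀ j, (ℓ j).IsHomogeneous 1)
    {φ : MvPolynomial σ R} {k : ℕ} (hφ : φ.IsHomogeneous k) : (bind₁ ℓ φ).IsHomogeneous k := by
  have h := hφ.eval₂ (C : R →+* MvPolynomial τ R) ℓ (fun r => isHomogeneous_C _ r) hℓ
  rw [one_mul] at h
  simpa only [bind₁, aeval_def, algebraMap_eq, coe_eval₂Hom] using h

/-- A polynomial of total degree `≤ M` is the sum of its homogeneous components of degrees `≤ M`. [folklore] -/
theorem sum_homogeneousComponent_of_le (φ : MvPolynomial σ R) {M : ℕ} (hM : φ.totalDegree ≤ M) :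
    ∑ i ∈ Finset.range (M + 1), homogeneousComponent i φ = φ := by
  rw [← Finset.sum_range_add_sum_Ico _ (show φ.totalDegree + 1 ≤ M + 1 by omega),
    sum_homogeneousComponent]
  suffices h0 : ∑ i ∈ Finset.Ico (φ.totalDegree + 1) (M + 1), homogeneousComponent i φ = 0 by
    rw [h0, add_zero]
  refine Finset.sum_eq_zero fun i hi => ?_
  rw [Finset.mem_Ico] at hi
  exact homogeneousComponent_eq_zero _ _ (by omega)

/-- In characteristic `2`, `a² - b² = (a - b)²`. [folklore] -/
theorem sq_sub_sq_of_two_eq_zero {A : Type*} [CommRing A] (h2 : (2 : A) = 0) (a b : A) :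
    a ^ 2 - b ^ 2 = (a - b) ^ 2 := by
  have : (a - b) ^ 2 = a ^ 2 - b ^ 2 + 2 * (b * (b - a)) := by ring
  rw [this, h2, zero_mul, add_zero]

end poly

/-! ## §1 Taylor rigidity at a rational regular point -/

section rational

variable {κ : Type u} {O : Type v} [Field κ] [CommRing O] [Algebra κ O]

/-- A form over `κ` of degree `k` whose value at a regular system of parameters lies in `𝔪^(k+1)` is zero
(Matsumura 17.10 through the INJECTIVE composite `κ → O → O/𝔪`). [cite: Matsumura1987, Thm. 17.10] -/
theorem eq_zero_of_isHomogeneous_of_aeval_mem_pow [IsRegularLocalRing O] {n : ℕ}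
    (hn : (maximalIdeal O).spanFinrank = n) (u : Fin n → O) (hu : Ideal.span (Set.range u) = maximalIdeal O)
    {k : ℕ} {P : MvPolynomial (Fin n) κ} (hP : P.IsHomogeneous k)
    (h : aeval u P ∈ maximalIdeal O ^ (k + 1)) : P = 0 := by
  have hF : (map (algebraMap κ O) P).IsHomogeneous k := hP.map _
  have hev : eval u (map (algebraMap κ O) P) = aeval u P := by rw [eval_map, aeval_def]
  have h0 := map_residue_eq_zero_of_eval_mem_pow_succ hn u hu hF (hev ▸ h)
  rw [map_map] at h0
  have hinj : Function.Injective ((residue O).comp (algebraMap κ O)) := RingHom.injective _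
  exact map_injective _ hinj (by rw [h0, map_zero])

/-- **Taylor rigidity.** A `κ`-polynomial of total degree `≤ N` whose value at a regular system of parameters of a
regular local `κ`-algebra lies in `𝔪^(N+1)` is zero: its lowest non-zero homogeneous component `P_k` would have
`P_k(u) ∈ 𝔪^(k+1)`. [cite: Matsumura1987, Thm. 17.10] -/
theorem eq_zero_of_totalDegree_le_of_aeval_mem_pow [IsRegularLocalRing O] {n : ℕ}
    (hn : (maximalIdeal O).spanFinrank = n) (u : Fin n → O) (hu : Ideal.span (Set.range u) = maximalIdeal O)
    {N : ℕ} {P : MvPolynomial (Fin n) κ} (hP : P.totalDegree ≤ N)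
    (h : aeval u P ∈ maximalIdeal O ^ (N + 1)) : P = 0 := by
  -- every homogeneous component of degree `≥ j` evaluates into `𝔪^j`
  have hcomp : ∀ i j, j ≤ i → aeval u (homogeneousComponent i P) ∈ maximalIdeal O ^ j := by
    intro i j hij
    have hmem : eval u (map (algebraMap κ O) (homogeneousComponent i P)) ∈
        Ideal.span (Set.range u) ^ i :=
      eval_mem_span_pow u ((homogeneousComponent_isHomogeneous i P).map _)
    rw [eval_map, ← aeval_def, hu] at hmem
    exact Ideal.pow_le_pow_right hij hmem
  -- by induction on `k`: all components of degree `< k` vanish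
  have key : ∀ k, k ≤ N + 1 → ∀ j, j < k → homogeneousComponent j P = 0 := by
    intro k
    induction k with
    | zero => intro _ j hj; omega
    | succ k ih =>
      intro hk j hj
      rcases Nat.lt_succ_iff_lt_or_eq.mp hj with hj | rfl
      · exact ih (by omega) j hj
      · -- the component of degree `j = k ≤ N`
        have hsum := sum_homogeneousComponent_of_le P hP
        have hmemk : j ∈ Finset.range (N + 1) := Finset.mem_range.mpr (by omega)
        have hsplit := (Finset.add_sum_erase (Finset.range (N + 1)) (fun i => homogeneousComponent i P) hmemk).symm
        have hrest : aeval u (∑ i ∈ (Finset.range (N + 1)).erase j, homogeneousComponent i P) ∈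
            maximalIdeal O ^ (j + 1) := by
          rw [map_sum]
          refine Ideal.sum_mem _ fun i hi => ?_
          obtain ⟨hij, -⟩ := Finset.mem_erase.mp hi
          rcases Nat.lt_or_gt_of_ne hij with hlt | hgt
          · rw [ih (by omega) i hlt, map_zero]; exact zero_mem _
          · exact hcomp i (j + 1) hgt
        have hP' : aeval u P = aeval u (homogeneousComponent j P) +
            aeval u (∑ i ∈ (Finset.range (N + 1)).erase j, homogeneousComponent i P) := by
          conv_lhs => rw [← hsum]
          rw [hsplit, map_add]
        have hPj : aeval u (homogeneousComponent j P) =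
            aeval u P - aeval u (∑ i ∈ (Finset.range (N + 1)).erase j, homogeneousComponent i P) :=
          eq_sub_of_add_eq hP'.symm
        refine eq_zero_of_isHomogeneous_of_aeval_mem_pow hn u hu (homogeneousComponent_isHomogeneous j P) ?_
        rw [hPj]
        exact sub_mem (Ideal.pow_le_pow_right (by omega) h) hrest
  rw [← sum_homogeneousComponent_of_le P hP]
  exact Finset.sum_eq_zero fun i hi => key (N + 1) le_rfl i (Finset.mem_range.mp hi)

/-! ## §2 Polynomial approximation of elements at a rational point -/

/-- At a RATIONAL point (`κ` maps onto the residue field) every element of `O` is congruent modulo `𝔪^(N+1)` to the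
value of a `κ`-polynomial of total degree `≤ N` in the regular parameters. [folklore] -/
theorem exists_totalDegree_le_sub_aeval_mem_pow [IsLocalRing O] {n : ℕ} (u : Fin n → O)
    (hu : Ideal.span (Set.range u) = maximalIdeal O)
    (hrat : ∀ o : O, ∃ c : κ, o - algebraMap κ O c ∈ maximalIdeal O) (N : ℕ) (o : O) :
    ∃ q : MvPolynomial (Fin n) κ, q.totalDegree ≤ N ∧ o - aeval u q ∈ maximalIdeal O ^ (N + 1) := by
  induction N generalizing o with
  | zero =>
    obtain ⟨c, hc⟩ := hrat o
    exact ⟨C c, by simp, by rwa [zero_add, pow_one, aeval_C]⟩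
  | succ N ih =>
    obtain ⟨c, hc⟩ := hrat o
    rw [← hu] at hc
    obtain ⟨a, ha⟩ := (Ideal.mem_span_range_iff_exists_fun (R := O)).mp hc
    choose q hq hqa using fun i => ih (a i)
    refine ⟨C c + ∑ i, X i * q i, ?_, ?_⟩
    · refine (totalDegree_add _ _).trans (max_le (by simp) ?_)
      refine totalDegree_finsetSum_le fun i _ => ?_
      refine (totalDegree_mul _ _).trans ?_
      rw [totalDegree_X]
      have := hq i
      omega
    · have h1 : o - aeval u (C c + ∑ i, X i * q i) =
          (o - algebraMap κ O c) - ∑ i, u i * aeval u (q i) := by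
        simp only [map_add, aeval_C, map_sum, map_mul, aeval_X]; ring
      have hexp : o - aeval u (C c + ∑ i, X i * q i) = ∑ i, u i * (a i - aeval u (q i)) := by
        rw [h1, ← ha, ← Finset.sum_sub_distrib]
        exact Finset.sum_congr rfl fun i _ => by ring
      rw [hexp]
      refine Ideal.sum_mem _ fun i _ => ?_
      rw [pow_succ']
      refine Ideal.mul_mem_mul ?_ (hqa i)
      rw [← hu]
      exact Ideal.subset_span ⟨i, rfl⟩

/-! ## §3 The binary (or `m`-ary) part modulo `𝔪^(d+1)` -/

/-- An element of `(ℓ₁(u), …, ℓ_m(u))^d`, `ℓ_i` linear `κ`-forms, is congruent modulo `𝔪^(d+1)` to `R(ℓ₁, …, ℓ_m)(u)` for a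
`κ`-form `R` of degree `d` in `m` letters (replace the `O`-coefficients of a degree-`d` form by their residues).
[folklore] -/
theorem exists_isHomogeneous_sub_aeval_bind₁_mem_pow [IsLocalRing O] {n : ℕ} (u : Fin n → O)
    (hu : Ideal.span (Set.range u) = maximalIdeal O)
    (hrat : ∀ o : O, ∃ c : κ, o - algebraMap κ O c ∈ maximalIdeal O) {m : ℕ}
    (ℓ : Fin m → MvPolynomial (Fin n) κ) (hℓ : ∀ i, (ℓ i).IsHomogeneous 1) {d : ℕ} {y : O}
    (hy : y ∈ Ideal.span (Set.range fun i => aeval u (ℓ i)) ^ d) :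
    ∃ R : MvPolynomial (Fin m) κ, R.IsHomogeneous d ∧
      y - aeval u (bind₁ ℓ R) ∈ maximalIdeal O ^ (d + 1) := by
  classical
  set v : Fin m → O := fun i => aeval u (ℓ i) with hv
  obtain ⟨H, hH, hHy⟩ := exists_isHomogeneous_of_mem_span_pow v d hy
  choose c hc using fun α : Fin m →₀ ℕ => hrat (H.coeff α)
  refine ⟨∑ α ∈ H.support, monomial α (c α), ?_, ?_⟩
  · refine IsHomogeneous.sum _ _ _ fun α hα => isHomogeneous_monomial _ ?_
    rw [Finsupp.degree_eq_weight_one]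
    exact hH (mem_support_iff.mp hα)
  · -- `y = Σ H_α v^α`, `R(ℓ)(u) = Σ c_α v^α`
    have hvm : ∀ i, v i ∈ maximalIdeal O := fun i => by
      have := eval_mem_span_pow u ((hℓ i).map (algebraMap κ O))
      rw [eval_map, ← aeval_def, pow_one, hu] at this
      exact this
    have hmon : ∀ α ∈ H.support, (α.prod fun i k => v i ^ k) ∈ maximalIdeal O ^ d := by
      intro α hα
      have hdeg : α.degree = d := by
        rw [Finsupp.degree_eq_weight_one]; exact hH (mem_support_iff.mp hα)
      have : eval v (monomial α (1 : O)) ∈ Ideal.span (Set.range v) ^ d :=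
        eval_mem_span_pow v (isHomogeneous_monomial _ hdeg)
      rw [eval_monomial, one_mul] at this
      refine Ideal.pow_right_mono (Ideal.span_le.mpr ?_) d this
      rintro _ ⟨i, rfl⟩
      exact hvm i
    have hyexp : y = ∑ α ∈ H.support, H.coeff α * α.prod fun i k => v i ^ k := by
      rw [← hHy, eval_eq]
      rfl
    have hRexp : aeval u (bind₁ ℓ (∑ α ∈ H.support, monomial α (c α))) =
        ∑ α ∈ H.support, algebraMap κ O (c α) * α.prod fun i k => v i ^ k := by
      rw [aeval_bind₁, map_sum]
      refine Finset.sum_congr rfl fun α _ => ?_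
      rw [aeval_monomial]
    rw [hyexp, hRexp, ← Finset.sum_sub_distrib]
    refine Ideal.sum_mem _ fun α hα => ?_
    rw [← sub_mul, pow_succ']
    exact Ideal.mul_mem_mul (hc α) (hmon α hα)

/-! ## §4 The restriction identity (characteristic 2) -/

/-- **The restriction identity** (idea-2 HEV-IDEA-2 §2 (★) + Lemma 1 in the exceptional divisor; characteristic `2`,
rational regular point). If a `κ`-polynomial `C` of total degree `≤ d = 2e` satisfies
`C(u) - g² ∈ (ℓ₁(u), …, ℓ_m(u))^d + 𝔪^(d+1)` for some `g ∈ O` and linear forms `ℓ_i`, then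
`C = q² + R(ℓ₁, …, ℓ_m)` EXACTLY, with `deg q ≤ e` and `R` a form of degree `d` in `m` letters. (`g ≡ q(u) (𝔪^(e+1))`
gives `g² ≡ q(u)² (𝔪^(d+2))` in characteristic `2`; the ideal part is `R(ℓ)(u) (𝔪^(d+1))` by §3; Taylor rigidity §1.)
[cite: Matsumura1987, Thm. 17.10] [folklore] -/
theorem eq_sq_add_bind₁_of_sub_sq_mem [IsRegularLocalRing O] (h2 : (2 : O) = 0) {n : ℕ}
    (hn : (maximalIdeal O).spanFinrank = n) (u : Fin n → O) (hu : Ideal.span (Set.range u) = maximalIdeal O)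
    (hrat : ∀ o : O, ∃ c : κ, o - algebraMap κ O c ∈ maximalIdeal O) {d e : ℕ} (hde : d = 2 * e)
    (C : MvPolynomial (Fin n) κ) (hC : C.totalDegree ≤ d) (g : O) {m : ℕ}
    (ℓ : Fin m → MvPolynomial (Fin n) κ) (hℓ : ∀ i, (ℓ i).IsHomogeneous 1)
    (h : aeval u C - g ^ 2 ∈
      Ideal.span (Set.range fun i => aeval u (ℓ i)) ^ d ⊔ maximalIdeal O ^ (d + 1)) :
    ∃ q : MvPolynomial (Fin n) κ, q.totalDegree ≤ e ∧ ∃ R : MvPolynomial (Fin m) κ, R.IsHomogeneous d ∧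
      C = q ^ 2 + bind₁ ℓ R := by
  obtain ⟨y, hy, w, hw, hyw⟩ := Submodule.mem_sup.mp h
  obtain ⟨q, hq, hqg⟩ := exists_totalDegree_le_sub_aeval_mem_pow u hu hrat e g
  obtain ⟨R, hR, hRy⟩ := exists_isHomogeneous_sub_aeval_bind₁_mem_pow u hu hrat ℓ hℓ hy
  refine ⟨q, hq, R, hR, ?_⟩
  rw [← sub_eq_zero]
  refine eq_zero_of_totalDegree_le_of_aeval_mem_pow hn u hu (N := d) ?_ ?_
  · refine (totalDegree_sub _ _).trans (max_le hC ((totalDegree_add _ _).trans (max_le ?_ ?_)))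
    · refine (totalDegree_pow _ _).trans ?_
      rw [hde]; exact Nat.mul_le_mul_left 2 hq
    · exact (isHomogeneous_bind₁ hℓ hR).totalDegree_le
  · have hsq : g ^ 2 - aeval u q ^ 2 ∈ maximalIdeal O ^ (d + 1) := by
      rw [sq_sub_sq_of_two_eq_zero h2]
      have := Ideal.pow_mem_pow hqg 2
      rw [← pow_mul] at this
      exact Ideal.pow_le_pow_right (by omega) this
    have hexp : aeval u (C - (q ^ 2 + bind₁ ℓ R)) =
        (y - aeval u (bind₁ ℓ R)) + w + (g ^ 2 - aeval u q ^ 2) := by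
      simp only [map_sub, map_add, map_pow]
      linear_combination (-1 : O) * hyw
    rw [hexp]
    exact add_mem (add_mem hRy hw) hsq

end rational

end Summit.ResolutionOfSingularities.ResolutionOfSingularities.Theorems.SwitchingDichotomy.BinaryResidue

end
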